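import Literature.NumberTheory.NumberFields.UnitGaloisTrace
import Literature.NumberTheory.NumberFields.ClassGroupUnitsGaloisModules
import Mathlib.NumberTheory.NumberField.CMField
import Mathlib.LinearAlgebra.Trace
import Mathlib.LinearAlgebra.FreeModule.PID
import Mathlib.RingTheory.IntegralDomain
import HarnessLib

/-!
# Herbrand's unit theorem, even part: for a CM field `K` Galois over `ℚ` and an EVEN character `θ ≠ 1`
# of `Gal(K/ℚ)` with values in `ℤ_pˣ` (`p ∤ [K:ℚ]`), the `θ`-part `e_θ(ℤ_p ⊗ E_K/μ_K)` of the units is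
# free of `ℤ_p`-rank ONE — and the count «at most `p` independent `θ`-eigen-units modulo `p`-th powers»

Topic `NumberTheory/NumberFields`; namespace `Literature.NumberTheory.NumberFields.UnitGalois` (continuing
`UnitGaloisTrace.lean`). THEOREMS ONLY (no definition, no named fact, no `sorry`): the tree's linear maps
`UnitGalois.unitsModTorsion σ` (`σ` acting on the free `ℤ`-module `E_K/μ_K = (𝓞 K)ˣ/torsion`) assemble to an
integral representation `ρ` of `Gal(K/ℚ)` (`exists_unitsModTorsionRep`), and every statement below is about an
arbitrary `ρ` with `ρ σ = unitsModTorsion σ`.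

THE THEOREM (Herbrand 1930/31; Artin 1932; «Minkowski units»). For a number field `K` Galois over `ℚ` with group
`G`, Dirichlet's unit theorem in Herbrand's Galois-module form says `ℚ ⊗ E_K ≅ ℚ[G/G_∞] ⊖ 𝟙` (`G_∞ = {1, c_w}` the
decomposition group of an infinite place), i.e. a character `θ ≠ 1` of degree one occurs in `ℂ ⊗ E_K` with
multiplicity `dim θ^{G_∞} = [θ(c_w) = 1]` ([Tate1984Stark] Ch. I §3 Prop. 3.4 with `S = {∞}`, §4.2 «l'isomorphie
`ℚU ≅ ℚX` est due à Herbrand»). For `K` a CM field (`c_w = c` the complex conjugation for every `w`): EVEN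
non-trivial characters occur ONCE, odd characters do not occur. The tree has the odd half as a vanishing statement
(`Summit…PrintCFram.HerbrandUnits.unitsChiComponent_eq_bot_of_odd`, on `ℤ_p ⊗ (𝓞 K)ˣ`); this file proves the even
half, integrally at a prime `p ∤ #G`, in the idempotent currency of `IntegralCharacterProjector.lean`
(`charProjector`, `chiComponent`, `baseChangeRep`):

* §1 (any commutative ring `k`, `|G| ∈ kˣ`, `θ : G →* kˣ`) `charProjector_character_isProj` — `e_θ` is the projection
  onto the `θ`-component; `trace_charProjector` — `tr e_ψ = |G|⁻¹ Σ_t ψ(t) tr ρ(t⁻¹)`; over a PID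
  `natCast_finrank_chiComponent_character` — **`rank_k e_θ(V) = |G|⁻¹ Σ_t θ(t) tr ρ(t⁻¹)`** for a `k`-lattice `V`
  (trace of an idempotent = rank of its image, Mathlib `LinearMap.IsProj.trace`).
* §2 `exists_unitsModTorsionRep` — a `Representation ℤ Gal(K/ℚ) (Additive ((𝓞 K)ˣ ⧸ torsion K))` with
  `ρ σ = unitsModTorsion σ`; `traceChar_baseChange_unitsModTorsionRep` — `tr(σ | ℤ_p ⊗ E/μ) = #Fix(σ) − 1` (the
  tree's `UnitGalois.trace_unitsModTorsion`, [Schoof2009] Prop. 13.7, base-changed).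
* §3 `sum_mul_card_fixed_eq` — `Σ_t θ(t)·#Fix(t) = Σ_w Σ_{t ∈ Stab w} θ(t)`; for a CM field
  `filter_smul_eq_eq_pair` — `Stab(w) = {1, c}` (Mathlib `mem_stabilizer_mk_iff`, `IsCMField.isConj`), hence
  `sum_mul_card_fixed_eq_finrank_of_even` — `Σ_t θ(t)·#Fix(t) = [K:ℚ]` for `θ` even.
* §4 **`finrank_chiComponent_unitsModTorsion_eq_one`** — `K` CM Galois over `ℚ`, `p ∤ [K:ℚ]`, `θ(c) = 1`, `θ ≠ 1`
  ⟹ `finrank ℤ_[p] e_θ(ℤ_p ⊗ E_K/μ_K) = 1` (and the module is free: a submodule of a free `ℤ_p`-module).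
* §5 (v2 append) the odd part (`= 0`) and the totally real case (`= 1` for every `θ ≠ 1`), same hypotheses.
* §6 (v3 append) the same three counts over ANY characteristic-zero principal ideal domain `k` with `|Gal(K/ℚ)| ∈ kˣ`
  (`…_of_isUnit_card`) and over any FIELD OF CHARACTERISTIC ZERO with no condition on `[K:ℚ]`
  (`finrank_chiComponent_unitsModTorsion_eq_one_of_charZero`, `…_eq_zero_of_odd_of_charZero`,
  `…_eq_one_of_isTotallyReal_of_charZero`): Herbrand's theorem in its rational form, character by character
  ([Tate1984Stark] Ch. I Prop. 3.4, `S = {∞}`), as needed for `ℚ̄_p`-coefficients on the layers of a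
  `ℤ_p`-tower (`p ∣ [K:ℚ]`).
* The COUNT consumed by Kummer-theoretic reflection arguments («at most `p` units `u_i` with
  `σ(u_i) = u_i^{e σ} γ^p`, `θ ≡ e` mod `p`, pairwise distinct mod `K^{×p}`») is the sequel file
  `UnitsEvenEigenunitsCount.lean`.

Not here: `S`-units (the `S ≠ {∞}` case of [Tate1984Stark] Ch. I Prop. 3.4);
the comparison with `unitsChiComponent ℚ K p θ ⊆ ℤ_p ⊗ (𝓞 K)ˣ` (torsion included), which differs from
`e_θ(ℤ_p ⊗ E/μ)` by `e_θ(ℤ_p ⊗ μ_K) = 0` for `θ` even.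

## References
* [Tate1984Stark] J. Tate, *Les conjectures de Stark sur les fonctions L d'Artin en s = 0*, PM 47 (1984), Ch. I §3
  (3.3, Prop. 3.4) and §4 (4.2: `ℚU ≅_G ℚX`, Herbrand [HeI], [HeII], Artin [ArE]).
* [Washington1997] L. Washington, *Introduction to Cyclotomic Fields*, GTM 83, §5.5 (units as Galois modules),
  §8.3 (the `p`-adic decomposition `E/E^p = ⊕_{i even} …` for `ℚ(ζ_p)`), §10.2 (its use in reflection theorems).
* [Lang1990] S. Lang, *Cyclotomic Fields I and II*, GTM 121, Ch. 3 §4 / Ch. 7 §5 («`ℰ_n/W_n ≈ ℤ[G_n^+]_0` … for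
  each even `χ ≠ 1`»).
* [Schoof2009] R. Schoof, *Catalan's Conjecture*, Prop. 13.7 (the character of the unit representation; tree file
  `UnitGaloisTrace.lean`).
-/

noncomputable section

namespace Literature.NumberTheory.NumberFields

namespace UnitGalois

open Literature.RepresentationTheory.FiniteGroups
open _root_.NumberField _root_.NumberField.Units _root_.NumberField.InfinitePlace _root_.Module
open scoped TensorProduct Classical

set_option maxSynthPendingDepth 3

/-! ## §1 Character projectors on lattices: `e_θ` is a projection and `rank e_θ(V) = tr e_θ` -/

section Projector

variable {k : Type*} [CommRing k] {G : Type*} [Group G] [Fintype G]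
  {V : Type*} [AddCommGroup V] [Module k V]

/-- For a character `θ : G →* kˣ` and `|G| ∈ kˣ`, **`e_θ` is the projection of `V` onto its `θ`-component**
(`= θ`-eigenspace): it maps into `e_θ V` and fixes it pointwise.
[cite: Lang1990, Ch. 2 §8 (the idempotent e_χ)] [cite: Washington1997, §6.3 (orthogonal idempotents ε_i of ℤ_p[G])] -/
theorem charProjector_character_isProj (ρ : Representation k G V) (θ : G →* kˣ)
    (hG : IsUnit (Fintype.card G : k)) :
    LinearMap.IsProj (chiComponent ρ (fun g => ((θ g : kˣ) : k)))
      (charProjector ρ (fun g => ((θ g : kˣ) : k))) where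
  map_mem v := charProjector_mem_chiComponent ρ _ v
  map_id v hv := charProjector_character_apply_of_forall ρ θ hG
    ((mem_chiComponent_character_iff ρ θ hG v).1 hv)

/-- **`tr e_ψ = |G|⁻¹ Σ_t ψ(t) tr ρ(t⁻¹)`** (linearity of the trace). [folklore] -/
private theorem trace_charProjector (ρ : Representation k G V) (ψ : G → k) :
    LinearMap.trace k V (charProjector ρ ψ) =
      Ring.inverse (Fintype.card G : k) * ∑ t, ψ t * traceChar ρ t⁻¹ := by
  unfold charProjector
  rw [map_smul, map_sum, smul_eq_mul]
  congr 1
  refine Finset.sum_congr rfl fun t _ => ?_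
  rw [map_smul, smul_eq_mul, traceChar_apply]

variable [IsDomain k] [IsPrincipalIdealRing k] [Module.Free k V] [Module.Finite k V]

/-- **Rank of the `θ`-component of a lattice = trace of the idempotent.** Over a principal ideal domain `k` with
`|G| ∈ kˣ`, for a representation `ρ` on a finite free `k`-module `V` and a character `θ : G →* kˣ`:
`rank_k e_θ(V) = |G|⁻¹ Σ_t θ(t) tr ρ(t⁻¹)` in `k` (the `θ`-component is a direct summand, hence free; the trace of a
projection is the rank of its image). For `k ⊇` the values of all characters this is the multiplicity
`⟨θ, χ_ρ⟩`. [cite: Tate1984Stark, Ch. I §3 Prop. 3.4 (r(χ) = ⟨χ, χ_X⟩)] [folklore] -/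
theorem natCast_finrank_chiComponent_character (ρ : Representation k G V) (θ : G →* kˣ)
    (hG : IsUnit (Fintype.card G : k)) :
    (finrank k (chiComponent ρ (fun g => ((θ g : kˣ) : k))) : k) =
      Ring.inverse (Fintype.card G : k) * ∑ t, ((θ t : kˣ) : k) * traceChar ρ t⁻¹ := by
  rw [← trace_charProjector, (charProjector_character_isProj ρ θ hG).trace]

end Projector

/-! ## §2 `E_K/μ_K` as an integral representation of `Gal(K/ℚ)` and the character of `ℤ_p ⊗ E_K/μ_K` -/

section UnitsRep

variable (K : Type*) [Field K] [NumberField K]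

/-- **`E_K/μ_K = (𝓞 K)ˣ/torsion` is an integral representation of `Gal(K/ℚ)`**: the tree's linear maps
`UnitGalois.unitsModTorsion σ` (`σ` on the free `ℤ`-module of rank `r₁ + r₂ − 1`) are multiplicative in `σ`, so
they assemble to a `Representation ℤ Gal(K/ℚ) (Additive ((𝓞 K)ˣ ⧸ torsion K))`. Stated as an existence (no new
definition); the results below hold for any representation `ρ` with `ρ σ = unitsModTorsion σ`.
[cite: Schoof2009, Proposition 13.7 (E_K/μ_K as a ℤ[G]-module)] [cite: Tate1984Stark, Ch. I §4 (4.2: U/μ(K) as a G-module)] -/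
theorem exists_unitsModTorsionRep :
    ∃ ρ : Representation ℤ Gal(K/ℚ) (Additive ((𝓞 K)ˣ ⧸ torsion K)), ∀ σ, ρ σ = unitsModTorsion σ := by
  refine ⟨{ toFun := unitsModTorsion, map_one' := ?_, map_mul' := fun σ τ => ?_ }, fun σ => rfl⟩
  · refine LinearMap.ext fun x => ?_
    obtain ⟨y, hy⟩ := QuotientGroup.mk_surjective (Additive.toMul x)
    have hx : x = Additive.ofMul (QuotientGroup.mk y : (𝓞 K)ˣ ⧸ torsion K) := by rw [hy, ofMul_toMul]
    rw [hx, unitsModTorsion_apply, unitsGal_one]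
    rfl
  · refine LinearMap.ext fun x => ?_
    obtain ⟨y, hy⟩ := QuotientGroup.mk_surjective (Additive.toMul x)
    have hx : x = Additive.ofMul (QuotientGroup.mk y : (𝓞 K)ˣ ⧸ torsion K) := by rw [hy, ofMul_toMul]
    rw [hx, Module.End.mul_apply, unitsModTorsion_apply, unitsModTorsion_apply, unitsModTorsion_apply,
      unitsGal_mul]

variable {K}

/-- The number of infinite places fixed by `σ⁻¹` equals the number fixed by `σ`. [folklore] -/
private theorem card_fixed_inv (σ : Gal(K/ℚ)) :
    Fintype.card {w : InfinitePlace K // σ⁻¹ • w = w} = Fintype.card {w : InfinitePlace K // σ • w = w} :=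
  Fintype.card_congr (Equiv.subtypeEquivRight fun w => by rw [inv_smul_eq_iff, eq_comm])

variable (p : ℕ) [Fact p.Prime]

/-- **The character of `ℤ_p ⊗ E_K/μ_K`**: `tr(σ | ℤ_p ⊗ E_K/μ_K) = #Fix(σ) − 1` (the tree's
`UnitGalois.trace_unitsModTorsion`, base-changed along `ℤ → ℤ_p` by `LinearMap.trace_baseChange`).
[cite: Schoof2009, Proposition 13.7 (proof)] [cite: Tate1984Stark, Ch. I §3 (3.3: χ_X = χ_Y − 1, χ_Y = Σ_v Ind 1)] -/
theorem traceChar_baseChange_unitsModTorsionRep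
    {ρ : Representation ℤ Gal(K/ℚ) (Additive ((𝓞 K)ˣ ⧸ torsion K))} (hρ : ∀ σ, ρ σ = unitsModTorsion σ)
    (σ : Gal(K/ℚ)) :
    traceChar (baseChangeRep ℤ_[p] ρ) σ = (Fintype.card {w : InfinitePlace K // σ • w = w} : ℤ_[p]) - 1 := by
  rw [traceChar_apply, baseChangeRep_apply, LinearMap.trace_baseChange, hρ, trace_unitsModTorsion]
  push_cast
  rfl

end UnitsRep

/-! ## §3 The character sum `Σ_t θ(t)·#Fix(t)` and the stabilizers of the infinite places of a CM field -/

section Sums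

variable {K : Type*} [Field K] [NumberField K] {R : Type*} [CommRing R]

/-- **`Σ_t θ(t)·#Fix(t) = Σ_w Σ_{t : t·w = w} θ(t)`** (count the pairs `(t, w)` with `t·w = w` both ways).
[cite: Tate1984Stark, Ch. I §3 (χ_Y = Σ_{v∈S} Ind_{G_w}^G 1)] [folklore] -/
theorem sum_mul_card_fixed_eq (θ : Gal(K/ℚ) → R) :
    ∑ t : Gal(K/ℚ), θ t * (Fintype.card {w : InfinitePlace K // t • w = w} : R) =
      ∑ w : InfinitePlace K, ∑ t ∈ Finset.univ.filter (fun t : Gal(K/ℚ) => t • w = w), θ t := by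
  classical
  have h1 : ∀ t : Gal(K/ℚ), (Fintype.card {w : InfinitePlace K // t • w = w} : R) =
      ∑ w : InfinitePlace K, if t • w = w then (1 : R) else 0 := fun t => by
    rw [Finset.sum_boole, Fintype.card_subtype]
  simp_rw [h1, Finset.mul_sum, mul_ite, mul_one, mul_zero]
  rw [Finset.sum_comm]
  refine Finset.sum_congr rfl fun w _ => ?_
  rw [Finset.sum_filter]

variable [IsCMField K]

/-- Complex conjugation of a CM field, as an element of `Gal(K/ℚ)`, is `≠ 1`. [folklore] -/
private theorem restrictScalars_complexConj_ne_one : (IsCMField.complexConj K).restrictScalars ℚ ≠ 1 := by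
  intro h
  apply IsCMField.complexConj_ne_one K
  ext x
  have hx := AlgEquiv.congr_fun h x
  rw [AlgEquiv.restrictScalars_apply] at hx
  rw [hx]
  rfl

/-- Complex conjugation is `IsConj` for every complex embedding of a CM field (Mathlib
`IsCMField.complexEmbedding_complexConj`, repackaged over `ℚ`). [folklore] -/
private theorem isConj_restrictScalars_complexConj (φ : K →+* ℂ) :
    ComplexEmbedding.IsConj φ ((IsCMField.complexConj K).restrictScalars ℚ) := by
  refine RingHom.ext fun x => ?_
  rw [ComplexEmbedding.conjugate_coe_eq, RingHom.coe_comp, Function.comp_apply]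
  change starRingEnd ℂ (φ x) = φ (((IsCMField.complexConj K).restrictScalars ℚ) x)
  rw [AlgEquiv.restrictScalars_apply, IsCMField.complexEmbedding_complexConj]

/-- `t ∈ Gal(K/ℚ)` fixes an infinite place of the CM field `K` iff `t ∈ {1, c}`. [folklore] -/
private theorem smul_infinitePlace_eq_iff (w : InfinitePlace K) (t : Gal(K/ℚ)) :
    t • w = w ↔ t = 1 ∨ t = (IsCMField.complexConj K).restrictScalars ℚ := by
  have h : t • w = w ↔ t ∈ MulAction.stabilizer Gal(K/ℚ) (mk (embedding w)) := by
    rw [MulAction.mem_stabilizer_iff, mk_embedding]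
  rw [h, mem_stabilizer_mk_iff]
  refine or_congr Iff.rfl ⟨fun ht => ht.ext (isConj_restrictScalars_complexConj (embedding w)),
    fun ht => ht ▸ isConj_restrictScalars_complexConj (embedding w)⟩

/-- **The stabilizer of an infinite place of a CM field is `{1, c}`.** [folklore] -/
private theorem filter_smul_eq_eq_pair (w : InfinitePlace K) :
    Finset.univ.filter (fun t : Gal(K/ℚ) => t • w = w) =
      {1, (IsCMField.complexConj K).restrictScalars ℚ} := by
  ext t
  rw [Finset.mem_filter, Finset.mem_insert, Finset.mem_singleton, smul_infinitePlace_eq_iff]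
  simp

/-- For a CM field `K` and `θ` EVEN (`θ(c) = 1`, `θ(1) = 1`): **`Σ_t θ(t)·#Fix(t) = 2·#{w ∣ ∞} = [K:ℚ]`**.
[cite: Tate1984Stark, Ch. I §3 Prop. 3.4 (Σ_v dim V^{G_w})] [folklore] -/
theorem sum_mul_card_fixed_eq_finrank_of_even (θ : Gal(K/ℚ) → R) (h1 : θ 1 = 1)
    (hc : θ ((IsCMField.complexConj K).restrictScalars ℚ) = 1) :
    ∑ t : Gal(K/ℚ), θ t * (Fintype.card {w : InfinitePlace K // t • w = w} : R) = (finrank ℚ K : R) := by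
  classical
  rw [sum_mul_card_fixed_eq]
  have h2 : ∀ w : InfinitePlace K, ∑ t ∈ Finset.univ.filter (fun t : Gal(K/ℚ) => t • w = w), θ t = 2 := by
    intro w
    rw [filter_smul_eq_eq_pair, Finset.sum_pair (Ne.symm restrictScalars_complexConj_ne_one), h1, hc]
    norm_num
  simp_rw [h2]
  rw [Finset.sum_const, Finset.card_univ, nsmul_eq_mul, IsTotallyComplex.finrank,
    card_eq_nrRealPlaces_add_nrComplexPlaces, IsTotallyComplex.nrRealPlaces_eq_zero, zero_add]
  push_cast
  ring

end Sums

/-! ## §4 Herbrand: the even `θ`-part of `ℤ_p ⊗ E_K/μ_K` has rank one -/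

section Herbrand

variable {K : Type*} [Field K] [NumberField K] [IsCMField K] [IsGalois ℚ K] {p : ℕ} [Fact p.Prime]

omit [IsCMField K] in
/-- `p ∤ [K:ℚ]` ⟹ `|Gal(K/ℚ)|` is a unit of `ℤ_p`. [folklore] -/
private theorem isUnit_card_gal (hpK : ¬ p ∣ finrank ℚ K) : IsUnit (Fintype.card Gal(K/ℚ) : ℤ_[p]) := by
  rw [← Nat.card_eq_fintype_card, IsGalois.card_aut_eq_finrank, PadicInt.isUnit_iff,
    PadicInt.norm_natCast_eq_one_iff]
  exact (Nat.Prime.coprime_iff_not_dvd Fact.out).2 hpK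

/-- **HERBRAND'S UNIT THEOREM, EVEN PART.** Let `K` be a CM field, Galois over `ℚ`, `p` a prime with `p ∤ [K:ℚ]`,
and `θ : Gal(K/ℚ) →* ℤ_pˣ` an EVEN (`θ(c) = 1`) non-trivial character. Then the `θ`-component
`e_θ(ℤ_p ⊗ E_K/μ_K)` of the `p`-completed units modulo torsion has `ℤ_p`-rank exactly ONE («one Minkowski unit
per even character»): `rank = |G|⁻¹(Σ_t θ(t)·#Fix(t) − Σ_t θ(t)) = |G|⁻¹(|G| − 0) = 1`.
[cite: Tate1984Stark, Ch. I §3 Prop. 3.4 and §4.2 (Herbrand: ℚU ≅_G ℚX)] [cite: Washington1997, §8.3 and §10.2 (even eigenspaces of E/E^p)] [cite: Lang1990, Ch. 7 §5 ("for each even χ ≠ 1")] -/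
theorem finrank_chiComponent_unitsModTorsion_eq_one (hpK : ¬ p ∣ finrank ℚ K)
    {ρ : Representation ℤ Gal(K/ℚ) (Additive ((𝓞 K)ˣ ⧸ torsion K))} (hρ : ∀ σ, ρ σ = unitsModTorsion σ)
    (θ : Gal(K/ℚ) →* ℤ_[p]ˣ) (hθ : θ ≠ 1) (hc : θ ((IsCMField.complexConj K).restrictScalars ℚ) = 1) :
    finrank ℤ_[p] (chiComponent (baseChangeRep ℤ_[p] ρ) (fun g => ((θ g : ℤ_[p]ˣ) : ℤ_[p]))) = 1 := by
  have hG := isUnit_card_gal (K := K) hpK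
  have h := natCast_finrank_chiComponent_character (baseChangeRep ℤ_[p] ρ) θ hG
  simp_rw [traceChar_baseChange_unitsModTorsionRep p hρ, card_fixed_inv, mul_sub, mul_one,
    Finset.sum_sub_distrib] at h
  rw [sum_mul_card_fixed_eq_finrank_of_even (fun g => ((θ g : ℤ_[p]ˣ) : ℤ_[p]))
    (by simp) (by rw [hc, Units.val_one])] at h
  have hsum : ∑ t : Gal(K/ℚ), ((θ t : ℤ_[p]ˣ) : ℤ_[p]) = 0 := by
    have h0 := sum_hom_units_eq_zero ((Units.coeHom ℤ_[p]).comp θ) (fun h1 => hθ (by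
      ext g
      have := DFunLike.congr_fun h1 g
      simpa using this))
    simpa using h0
  rw [hsum, sub_zero, ← IsGalois.card_aut_eq_finrank, Nat.card_eq_fintype_card,
    Ring.inverse_mul_cancel _ hG] at h
  exact_mod_cast h

end Herbrand

/-! ## §5 (v2 append) The complementary cases: odd characters of a CM field, and totally real fields -/

section Complement

variable {K : Type*} [Field K] [NumberField K] [IsGalois ℚ K] {p : ℕ} [Fact p.Prime]

/-- **HERBRAND, ODD PART (rank zero).** For `K` CM Galois over `ℚ`, `p ∤ [K:ℚ]`, and `θ : Gal(K/ℚ) →* ℤ_pˣ` ODD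
(`θ(c) = −1`): `finrank ℤ_[p] e_θ(ℤ_p ⊗ E_K/μ_K) = 0` — odd characters do not occur in `E_K ⊗ ℚ ≅ ℚ[G/⟨c⟩] ⊖ 𝟙`
(`Σ_{t ∈ {1,c}} θ(t) = 0` at every infinite place). The tree's `…PrintCFram.HerbrandUnits.unitsChiComponent_eq_bot_of_odd`
is the same fact on `ℤ_p ⊗ (𝓞 K)ˣ` (torsion included).
[cite: Tate1984Stark, Ch. I §3 Prop. 3.4] [cite: Washington1997, §10.2 (odd eigenspaces of the units)] -/
theorem finrank_chiComponent_unitsModTorsion_eq_zero_of_odd [IsCMField K] (hpK : ¬ p ∣ finrank ℚ K)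
    {ρ : Representation ℤ Gal(K/ℚ) (Additive ((𝓞 K)ˣ ⧸ torsion K))} (hρ : ∀ σ, ρ σ = unitsModTorsion σ)
    (θ : Gal(K/ℚ) →* ℤ_[p]ˣ) (hc : θ ((IsCMField.complexConj K).restrictScalars ℚ) = -1) :
    finrank ℤ_[p] (chiComponent (baseChangeRep ℤ_[p] ρ) (fun g => ((θ g : ℤ_[p]ˣ) : ℤ_[p]))) = 0 := by
  have hG := isUnit_card_gal (K := K) hpK
  have hθ : θ ≠ 1 := fun h1 => by
    rw [h1, MonoidHom.one_apply] at hc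
    have h2 : ((1 : ℤ_[p]ˣ) : ℤ_[p]) = -1 := by rw [hc, Units.val_neg, Units.val_one]
    have hp2 : (2 : ℤ_[p]) = 0 := by rw [Units.val_one] at h2; linear_combination h2
    have hne : (2 : ℤ_[p]) ≠ 0 := two_ne_zero
    exact hne hp2
  have h := natCast_finrank_chiComponent_character (baseChangeRep ℤ_[p] ρ) θ hG
  simp_rw [traceChar_baseChange_unitsModTorsionRep p hρ, card_fixed_inv, mul_sub, mul_one,
    Finset.sum_sub_distrib, sum_mul_card_fixed_eq] at h
  have h2 : ∀ w : InfinitePlace K,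
      ∑ t ∈ Finset.univ.filter (fun t : Gal(K/ℚ) => t • w = w), ((θ t : ℤ_[p]ˣ) : ℤ_[p]) = 0 := by
    intro w
    rw [filter_smul_eq_eq_pair, Finset.sum_pair (Ne.symm restrictScalars_complexConj_ne_one), map_one, hc,
      Units.val_neg, Units.val_one, add_neg_cancel]
  simp_rw [h2] at h
  have hsum : ∑ t : Gal(K/ℚ), ((θ t : ℤ_[p]ˣ) : ℤ_[p]) = 0 := by
    have h0 := sum_hom_units_eq_zero ((Units.coeHom ℤ_[p]).comp θ) (fun h1 => hθ (by
      ext g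
      have := DFunLike.congr_fun h1 g
      simpa using this))
    simpa using h0
  rw [Finset.sum_const_zero, hsum, sub_zero, mul_zero] at h
  exact_mod_cast h

omit [IsGalois ℚ K] in
/-- In a totally real field every infinite place has trivial stabilizer in `Gal(K/ℚ)`. [folklore] -/
private theorem filter_smul_eq_eq_singleton_of_isTotallyReal [IsTotallyReal K] (w : InfinitePlace K) :
    Finset.univ.filter (fun t : Gal(K/ℚ) => t • w = w) = {1} := by
  ext t
  rw [Finset.mem_filter, Finset.mem_singleton]
  simp only [Finset.mem_univ, true_and]
  have h : t • w = w ↔ t ∈ MulAction.stabilizer Gal(K/ℚ) (mk (embedding w)) := by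
    rw [MulAction.mem_stabilizer_iff, mk_embedding]
  rw [h, mem_stabilizer_mk_iff]
  refine ⟨fun ht => ht.elim id fun hconj => ?_, fun ht => Or.inl ht⟩
  exact hconj.ext (ComplexEmbedding.isConj_one_iff.2 (IsTotallyReal.isReal (mk (embedding w))
    |> fun hw => by rwa [isReal_mk_iff] at hw))

/-- **HERBRAND FOR A TOTALLY REAL FIELD (rank one for every `θ ≠ 1`).** For `K` totally real, Galois over `ℚ`,
`p ∤ [K:ℚ]`, and `θ : Gal(K/ℚ) →* ℤ_pˣ`, `θ ≠ 1`: `finrank ℤ_[p] e_θ(ℤ_p ⊗ E_K/μ_K) = 1` (`E_K ⊗ ℚ ≅ ℚ[G] ⊖ 𝟙`: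
Minkowski's unit theorem). [cite: Tate1984Stark, Ch. I §3 Prop. 3.4 and §4.2] [cite: Washington1997, §5.5] -/
theorem finrank_chiComponent_unitsModTorsion_eq_one_of_isTotallyReal [IsTotallyReal K]
    (hpK : ¬ p ∣ finrank ℚ K)
    {ρ : Representation ℤ Gal(K/ℚ) (Additive ((𝓞 K)ˣ ⧸ torsion K))} (hρ : ∀ σ, ρ σ = unitsModTorsion σ)
    (θ : Gal(K/ℚ) →* ℤ_[p]ˣ) (hθ : θ ≠ 1) :
    finrank ℤ_[p] (chiComponent (baseChangeRep ℤ_[p] ρ) (fun g => ((θ g : ℤ_[p]ˣ) : ℤ_[p]))) = 1 := by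
  have hG := isUnit_card_gal (K := K) hpK
  have h := natCast_finrank_chiComponent_character (baseChangeRep ℤ_[p] ρ) θ hG
  simp_rw [traceChar_baseChange_unitsModTorsionRep p hρ, card_fixed_inv, mul_sub, mul_one,
    Finset.sum_sub_distrib, sum_mul_card_fixed_eq] at h
  have h2 : ∀ w : InfinitePlace K,
      ∑ t ∈ Finset.univ.filter (fun t : Gal(K/ℚ) => t • w = w), ((θ t : ℤ_[p]ˣ) : ℤ_[p]) = 1 := by
    intro w
    rw [filter_smul_eq_eq_singleton_of_isTotallyReal, Finset.sum_singleton, map_one, Units.val_one]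
  simp_rw [h2] at h
  have hsum : ∑ t : Gal(K/ℚ), ((θ t : ℤ_[p]ˣ) : ℤ_[p]) = 0 := by
    have h0 := sum_hom_units_eq_zero ((Units.coeHom ℤ_[p]).comp θ) (fun h1 => hθ (by
      ext g
      have := DFunLike.congr_fun h1 g
      simpa using this))
    simpa using h0
  rw [Finset.sum_const, Finset.card_univ, nsmul_eq_mul, mul_one, hsum, sub_zero,
    card_eq_nrRealPlaces_add_nrComplexPlaces, IsTotallyReal.nrComplexPlaces_eq_zero, add_zero,
    ← IsTotallyReal.finrank, ← IsGalois.card_aut_eq_finrank, Nat.card_eq_fintype_card,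
    Ring.inverse_mul_cancel _ hG] at h
  exact_mod_cast h

end Complement

/-! ## §6 (v3 append) Coefficients in ANY principal ideal domain `k` of characteristic zero with `|G| ∈ kˣ` —
in particular in any field of characteristic zero (`ℚ̄_p`-coefficients: no hypothesis `p ∤ [K:ℚ]`)

§4–§5 take `k = ℤ_p` with `p ∤ [K:ℚ]` (integral idempotents). The same three counts hold verbatim over any
principal ideal domain `k` of characteristic zero in which `|Gal(K/ℚ)|` is invertible — the proofs of §4–§5 only use
`natCast_finrank_chiComponent_character` (§1, any such `k`) and the character `#Fix(σ) − 1` (§2, base change along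
`ℤ → k`) — and hence over every FIELD OF CHARACTERISTIC ZERO with no condition on `[K:ℚ]`: this is Herbrand's
theorem in its rational form `ℚ ⊗ E_K ≅ ℚ[G/G_∞] ⊖ 𝟙` read character by character
([Tate1984Stark] Ch. I Prop. 3.4 with `S = {∞}`: the multiplicity of a degree-one `θ ≠ 1` in `ℂU ≅ ℂX` is
`dim θ^{G_∞} − dim θ^{G} = [θ(c) = 1]`), the form needed for the layers `K = F'_n` of a cyclotomic `ℤ_p`-tower,
where `p ∣ [K:ℚ]`. -/

section AnyCoefficients

variable {K : Type*} [Field K] [NumberField K]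

/-- **The character of `k ⊗ E_K/μ_K` over any commutative coefficient ring `k`**:
`tr(σ | k ⊗ E_K/μ_K) = #Fix(σ) − 1` (the tree's `UnitGalois.trace_unitsModTorsion`, base-changed along `ℤ → k`
by `LinearMap.trace_baseChange`).
[cite: Tate1984Stark, Ch. I §3 (3.3: χ_X = χ_Y − 1, χ_Y = Σ_v Ind_{G_w}^G 1) and §4 (4.2: ℂU ≅ ℂX)] [cite: Schoof2009, Proposition 13.7 (proof)] -/
theorem traceChar_baseChange_unitsModTorsionRep_of_commRing (k : Type*) [CommRing k]
    {ρ : Representation ℤ Gal(K/ℚ) (Additive ((𝓞 K)ˣ ⧸ torsion K))} (hρ : ∀ σ, ρ σ = unitsModTorsion σ)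
    (σ : Gal(K/ℚ)) :
    traceChar (baseChangeRep k ρ) σ = (Fintype.card {w : InfinitePlace K // σ • w = w} : k) - 1 := by
  rw [traceChar_apply, baseChangeRep_apply, LinearMap.trace_baseChange, hρ, trace_unitsModTorsion, map_sub,
    map_one, map_natCast]

/-- **`rank_k e_θ(k ⊗ E_K/μ_K) · 1 = |G|⁻¹ (Σ_t θ(t)·#Fix(t) − Σ_t θ(t))` in `k`**, for any principal ideal
domain `k` with `|Gal(K/ℚ)| ∈ kˣ` and any character `θ : Gal(K/ℚ) →* kˣ` (§1 applied to the character of §6;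
the common first step of the three counts below). [cite: Tate1984Stark, Ch. I §3 Prop. 3.4 (r(χ) = ⟨χ, χ_X⟩, χ_X = χ_Y − 1)] -/
theorem natCast_finrank_chiComponent_unitsModTorsion {k : Type*} [CommRing k] [IsDomain k]
    [IsPrincipalIdealRing k] (hG : IsUnit (Fintype.card Gal(K/ℚ) : k))
    {ρ : Representation ℤ Gal(K/ℚ) (Additive ((𝓞 K)ˣ ⧸ torsion K))} (hρ : ∀ σ, ρ σ = unitsModTorsion σ)
    (θ : Gal(K/ℚ) →* kˣ) :
    (finrank k (chiComponent (baseChangeRep k ρ) (fun g => ((θ g : kˣ) : k))) : k) =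
      Ring.inverse (Fintype.card Gal(K/ℚ) : k) *
        (∑ t : Gal(K/ℚ), ((θ t : kˣ) : k) * (Fintype.card {w : InfinitePlace K // t • w = w} : k) -
          ∑ t : Gal(K/ℚ), ((θ t : kˣ) : k)) := by
  have h := natCast_finrank_chiComponent_character (baseChangeRep k ρ) θ hG
  simp_rw [traceChar_baseChange_unitsModTorsionRep_of_commRing k hρ, card_fixed_inv, mul_sub, mul_one,
    Finset.sum_sub_distrib] at h
  exact h

/-- `Σ_t θ(t) = 0` for a non-trivial character with values in a domain. [folklore] -/
private theorem sum_character_eq_zero {k : Type*} [CommRing k] [IsDomain k] (θ : Gal(K/ℚ) →* kˣ) (hθ : θ ≠ 1) :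
    ∑ t : Gal(K/ℚ), ((θ t : kˣ) : k) = 0 := by
  have h0 := sum_hom_units_eq_zero ((Units.coeHom k).comp θ) (fun h1 => hθ (by
    ext g
    have := DFunLike.congr_fun h1 g
    simpa using this))
  simpa using h0

/-- **HERBRAND, EVEN PART, over any characteristic-zero PID `k` with `|G| ∈ kˣ`.** `K` CM Galois over `ℚ`, `θ : Gal(K/ℚ) →* kˣ` even
(`θ(c) = 1`) and `≠ 1` ⟹ `rank_k e_θ(k ⊗ E_K/μ_K) = 1`. (§4 is the case `k = ℤ_p`, `p ∤ [K:ℚ]`.)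
[cite: Tate1984Stark, Ch. I §3 Prop. 3.4 and §4.2 (Herbrand: ℚU ≅_G ℚX)] [cite: Washington1997, §5.5] [cite: Lang1990, Ch. 7 §5 ("for each even χ ≠ 1")] -/
theorem finrank_chiComponent_unitsModTorsion_eq_one_of_isUnit_card [IsCMField K] [IsGalois ℚ K]
    {k : Type*} [CommRing k] [IsDomain k] [IsPrincipalIdealRing k] [CharZero k]
    (hG : IsUnit (Fintype.card Gal(K/ℚ) : k))
    {ρ : Representation ℤ Gal(K/ℚ) (Additive ((𝓞 K)ˣ ⧸ torsion K))} (hρ : ∀ σ, ρ σ = unitsModTorsion σ)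
    (θ : Gal(K/ℚ) →* kˣ) (hθ : θ ≠ 1) (hc : θ ((IsCMField.complexConj K).restrictScalars ℚ) = 1) :
    finrank k (chiComponent (baseChangeRep k ρ) (fun g => ((θ g : kˣ) : k))) = 1 := by
  have h := natCast_finrank_chiComponent_unitsModTorsion hG hρ θ
  rw [sum_mul_card_fixed_eq_finrank_of_even (fun g => ((θ g : kˣ) : k)) (by simp) (by rw [hc, Units.val_one]),
    sum_character_eq_zero θ hθ, sub_zero, ← IsGalois.card_aut_eq_finrank, Nat.card_eq_fintype_card,
    Ring.inverse_mul_cancel _ hG] at h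
  exact_mod_cast h

/-- **HERBRAND, ODD PART, over any characteristic-zero PID `k` with `|G| ∈ kˣ`.** `K` CM Galois over `ℚ`, `θ : Gal(K/ℚ) →* kˣ` odd
(`θ(c) = −1`) ⟹ `rank_k e_θ(k ⊗ E_K/μ_K) = 0` (`θ ≠ 1` is automatic in characteristic zero).
[cite: Tate1984Stark, Ch. I §3 Prop. 3.4] [cite: Washington1997, §10.2 (odd eigenspaces of the units)] -/
theorem finrank_chiComponent_unitsModTorsion_eq_zero_of_odd_of_isUnit_card [IsCMField K] [IsGalois ℚ K]
    {k : Type*} [CommRing k] [IsDomain k] [IsPrincipalIdealRing k] [CharZero k]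
    (hG : IsUnit (Fintype.card Gal(K/ℚ) : k))
    {ρ : Representation ℤ Gal(K/ℚ) (Additive ((𝓞 K)ˣ ⧸ torsion K))} (hρ : ∀ σ, ρ σ = unitsModTorsion σ)
    (θ : Gal(K/ℚ) →* kˣ) (hc : θ ((IsCMField.complexConj K).restrictScalars ℚ) = -1) :
    finrank k (chiComponent (baseChangeRep k ρ) (fun g => ((θ g : kˣ) : k))) = 0 := by
  have hθ : θ ≠ 1 := fun h1 => by
    rw [h1, MonoidHom.one_apply] at hc
    have hval : ((1 : kˣ) : k) = -1 := by rw [hc, Units.val_neg, Units.val_one]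
    rw [Units.val_one] at hval
    have h20 : (2 : k) = 0 := by linear_combination hval
    exact two_ne_zero h20
  have h := natCast_finrank_chiComponent_unitsModTorsion hG hρ θ
  rw [sum_mul_card_fixed_eq] at h
  have h3 : ∀ w : InfinitePlace K,
      ∑ t ∈ Finset.univ.filter (fun t : Gal(K/ℚ) => t • w = w), ((θ t : kˣ) : k) = 0 := by
    intro w
    rw [filter_smul_eq_eq_pair, Finset.sum_pair (Ne.symm restrictScalars_complexConj_ne_one), map_one, hc,
      Units.val_neg, Units.val_one, add_neg_cancel]
  simp_rw [h3] at h
  rw [Finset.sum_const_zero, sum_character_eq_zero θ hθ, sub_zero, mul_zero] at h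
  exact_mod_cast h

/-- **HERBRAND FOR A TOTALLY REAL FIELD, over any characteristic-zero PID `k` with `|G| ∈ kˣ`** (Minkowski units): `K` totally real,
Galois over `ℚ`, `θ : Gal(K/ℚ) →* kˣ`, `θ ≠ 1` ⟹ `rank_k e_θ(k ⊗ E_K/μ_K) = 1`.
[cite: Tate1984Stark, Ch. I §3 Prop. 3.4 and §4.2] [cite: Washington1997, §5.5] -/
theorem finrank_chiComponent_unitsModTorsion_eq_one_of_isTotallyReal_of_isUnit_card [IsTotallyReal K]
    [IsGalois ℚ K] {k : Type*} [CommRing k] [IsDomain k] [IsPrincipalIdealRing k] [CharZero k]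
    (hG : IsUnit (Fintype.card Gal(K/ℚ) : k))
    {ρ : Representation ℤ Gal(K/ℚ) (Additive ((𝓞 K)ˣ ⧸ torsion K))} (hρ : ∀ σ, ρ σ = unitsModTorsion σ)
    (θ : Gal(K/ℚ) →* kˣ) (hθ : θ ≠ 1) :
    finrank k (chiComponent (baseChangeRep k ρ) (fun g => ((θ g : kˣ) : k))) = 1 := by
  have h := natCast_finrank_chiComponent_unitsModTorsion hG hρ θ
  rw [sum_mul_card_fixed_eq] at h
  have h3 : ∀ w : InfinitePlace K,
      ∑ t ∈ Finset.univ.filter (fun t : Gal(K/ℚ) => t • w = w), ((θ t : kˣ) : k) = 1 := by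
    intro w
    rw [filter_smul_eq_eq_singleton_of_isTotallyReal, Finset.sum_singleton, map_one, Units.val_one]
  simp_rw [h3] at h
  rw [Finset.sum_const, Finset.card_univ, nsmul_eq_mul, mul_one, sum_character_eq_zero θ hθ, sub_zero,
    card_eq_nrRealPlaces_add_nrComplexPlaces, IsTotallyReal.nrComplexPlaces_eq_zero, add_zero,
    ← IsTotallyReal.finrank, ← IsGalois.card_aut_eq_finrank, Nat.card_eq_fintype_card,
    Ring.inverse_mul_cancel _ hG] at h
  exact_mod_cast h

/-! ### Fields of characteristic zero (`|G| ∈ kˣ` automatically): the form used with `ℚ̄_p`-coefficients -/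

/-- In a field of characteristic zero `|Gal(K/ℚ)|` is invertible. [folklore] -/
private theorem isUnit_card_gal_of_charZero (k : Type*) [Field k] [CharZero k] :
    IsUnit (Fintype.card Gal(K/ℚ) : k) :=
  isUnit_iff_ne_zero.2 (Nat.cast_ne_zero.2 Fintype.card_ne_zero)

/-- **HERBRAND'S UNIT THEOREM BY CHARACTERS over a field `k` of characteristic zero — even part.** For `K` a CM
field Galois over `ℚ` and `θ : Gal(K/ℚ) →* kˣ` EVEN, `θ ≠ 1`: `dim_k e_θ(k ⊗ E_K/μ_K) = 1`, with NO condition on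
`[K:ℚ]` (e.g. `k = ℚ̄_p ⊇ θ(G)` and `p ∣ [K:ℚ]`, the layers of a cyclotomic `ℤ_p`-tower over an imaginary
abelian field). [cite: Tate1984Stark, Ch. I §3 Prop. 3.4 (S = {∞}: r(θ) = dim θ^{G_∞} − dim θ^G) and §4.2 (ℂU ≅ ℂX; Herbrand: ℚU ≅_G ℚX)] [cite: Washington1997, §5.5] -/
theorem finrank_chiComponent_unitsModTorsion_eq_one_of_charZero [IsCMField K] [IsGalois ℚ K]
    (k : Type*) [Field k] [CharZero k]
    {ρ : Representation ℤ Gal(K/ℚ) (Additive ((𝓞 K)ˣ ⧸ torsion K))} (hρ : ∀ σ, ρ σ = unitsModTorsion σ)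
    (θ : Gal(K/ℚ) →* kˣ) (hθ : θ ≠ 1) (hc : θ ((IsCMField.complexConj K).restrictScalars ℚ) = 1) :
    finrank k (chiComponent (baseChangeRep k ρ) (fun g => ((θ g : kˣ) : k))) = 1 :=
  finrank_chiComponent_unitsModTorsion_eq_one_of_isUnit_card (isUnit_card_gal_of_charZero k) hρ θ hθ hc

/-- **— odd part:** `K` CM Galois over `ℚ`, `k` a field of characteristic zero, `θ : Gal(K/ℚ) →* kˣ` ODD ⟹
`dim_k e_θ(k ⊗ E_K/μ_K) = 0`. [cite: Tate1984Stark, Ch. I §3 Prop. 3.4 (S = {∞})] [cite: Washington1997, §10.2] -/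
theorem finrank_chiComponent_unitsModTorsion_eq_zero_of_odd_of_charZero [IsCMField K] [IsGalois ℚ K]
    (k : Type*) [Field k] [CharZero k]
    {ρ : Representation ℤ Gal(K/ℚ) (Additive ((𝓞 K)ˣ ⧸ torsion K))} (hρ : ∀ σ, ρ σ = unitsModTorsion σ)
    (θ : Gal(K/ℚ) →* kˣ) (hc : θ ((IsCMField.complexConj K).restrictScalars ℚ) = -1) :
    finrank k (chiComponent (baseChangeRep k ρ) (fun g => ((θ g : kˣ) : k))) = 0 :=
  finrank_chiComponent_unitsModTorsion_eq_zero_of_odd_of_isUnit_card (isUnit_card_gal_of_charZero k) hρ θ hc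

/-- **— totally real field:** `K` totally real Galois over `ℚ`, `k` a field of characteristic zero,
`θ : Gal(K/ℚ) →* kˣ`, `θ ≠ 1` ⟹ `dim_k e_θ(k ⊗ E_K/μ_K) = 1`. [cite: Tate1984Stark, Ch. I §3 Prop. 3.4 and §4.2] [cite: Washington1997, §5.5] -/
theorem finrank_chiComponent_unitsModTorsion_eq_one_of_isTotallyReal_of_charZero [IsTotallyReal K]
    [IsGalois ℚ K] (k : Type*) [Field k] [CharZero k]
    {ρ : Representation ℤ Gal(K/ℚ) (Additive ((𝓞 K)ˣ ⧸ torsion K))} (hρ : ∀ σ, ρ σ = unitsModTorsion σ)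
    (θ : Gal(K/ℚ) →* kˣ) (hθ : θ ≠ 1) :
    finrank k (chiComponent (baseChangeRep k ρ) (fun g => ((θ g : kˣ) : k))) = 1 :=
  finrank_chiComponent_unitsModTorsion_eq_one_of_isTotallyReal_of_isUnit_card (isUnit_card_gal_of_charZero k)
    hρ θ hθ

end AnyCoefficients

end UnitGalois

end Literature.NumberTheory.NumberFields

end
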